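import Literature.Barriers.HodgeConjecture.HodgeLocusAlgebraicChartedTensorConstructions
import Literature.AlgebraicGeometry.HodgeTheory.VHSDataNonGenericHodgeClassesDescent
import HarnessLib

/-!
# Cattani–Deligne–Kaplan over a curve: the points carrying a NON-GENERIC integral Hodge class of bounded norm form a PROPER Zariski-closed (finite)
# subset of `S(ℂ)` — from bundled flat charts, through a cover, from interior charts downstairs and puncture charts upstairs, for tensor constructions

[topic Barriers/HodgeConjecture]

Topic `Literature/Barriers/HodgeConjecture` (namespace `Literature.Barriers.HodgeConjecture`), lane `lit-hodgefound` (seat `p08`, row g60-#10).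
THEOREMS ONLY: no definition, NO new named fact (the barrier `CattaniDeligneKaplan1995_hodgeLocus_algebraicFor` is the tree's,
`Barriers/HodgeConjecture/HodgeLocusAlgebraic`), no instance, no notation (D-0026 net debt `0`).  JUNCTION of the barrier files
`HodgeLocusAlgebraicOverCurve` (finite ⟹ Zariski closed on points) ∕ `HodgeLocusAlgebraicChartedTensorConstructions` with the generation-60 files
`HodgeTheory/VHSDataNonGenericHodgeClassesFinite` ∕ `…Descent` (`VHSData.nonGenericHodgeLocus D p K`: the points carrying an integral class of type
`(p,p)` with `Q(u,u) ≤ K` admitting NO determination of type `(p,p)` at some point; finite for a locally flat-charted variation over a curve; descends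
along covers; invariant under isometric isomorphism; tensor constructions).

PRINTED SOURCE, VERBATIM (E. Cattani, P. Deligne, A. Kaplan, *On the locus of Hodge classes*, J. AMS 8 (1995); held text `paper:arxiv-alg-geom_9402009`
p0001–p0002).  P. 484: «locally on `S`, `S^{(K)}` is a finite disjoint sum of closed analytic subspaces. Our main result is: **Theorem 1.1.** `S^{(K)}` is
an algebraic variety, finite over `S`.»; «**Corollary 1.3.** … The set of points in `S` where some determination of `u` is of type `(0,0)`, is an
algebraic subvariety of `S`. *Proof*: Such set is a union of images of connected components of `S^{(K)}`, for `K = Q(u,u)`.»; p. 485: «To prove 1.1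
one is free to replace `S` of 1.1 by a finite etale covering `S′ → S`.»  Over a connected curve: a pair `(s,u) ∈ S^{(K)}` on a component dominating
`S` has determinations of type `(p,p)` everywhere, so the non-generic pairs lie on the finitely many zero-dimensional components, over a finite — proper
Zariski-closed — set of points.

* §1 **`isZariskiClosedOnPoints_nonGenericHodgeLocus_of_isLocallyFlatCharted_of_compactification`** and
  **`exists_isZariskiClosedOnPoints_ne_univ_forall_generic_of_compactification`**: for `D : GeometricVHSData B f n (2p)` locally flat-charted over a
  punctured compact curve, the non-generic Hodge locus of every norm bound is the set of complex points of a Zariski-closed subset of `S`, PROPER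
  (`S(ℂ)` is infinite), off which every integral class of type `(p,p)` with `Q(u,u) ≤ K` has a determination of type `(p,p)` at every complex point;
  `…_of_compactSpace` over a complete curve.
* §2 THROUGH A COVER: **`isZariskiClosedOnPoints_nonGenericHodgeLocus_of_cover_of_compactification`** (flat charts of `φ^*D` on a surjective cover
  `φ : T → S(ℂ)` by a punctured compact curve) and **`…_of_sheets_of_compactification`** (flat interior charts of `D` downstairs, flat puncture charts of
  `φ^*D` upstairs, `φ` a covering map).
* §3 TENSOR CONSTRUCTIONS from flat charts of `D` (resp. `D₁`, `D₂`) alone: `…_tensorSpace_…`, `…_hom_…` (two families over the same curve).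

HONEST SCOPE: `dim S = 1`; the bundled flat charts, covers and compactifications are HYPOTHESES; the analytic structure of `S^{(K)}` and its
components are not formalized; HC ∕ HC_CM are not touched.

## References

* [CattaniDeligneKaplan1995] E. Cattani, P. Deligne, A. Kaplan, *On the locus of Hodge classes*, J. Amer. Math. Soc. 8 (1995) 483–506: §1, Thm. 1.1,
  Cor. 1.3 (p. 484), «Proof of 1.5 ⟹ 1.1» (p. 485), 2.3 (p. 487), (2.4) (p. 488).
* [Hartshorne1977] R. Hartshorne, *Algebraic Geometry* (1977), Ch. II Ex. 3.14 (closed points of a scheme of finite type over a field).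
* [FritzscheGrauert2002] K. Fritzsche, H. Grauert, *From Holomorphic Functions to Complex Manifolds*, GTM 213 (2002), Ch. I §8, Ch. IV §1 (cite only).
-/

noncomputable section

open scoped TensorProduct ComplexOrder
open _root_.Topology _root_.Filter Set
open AlgebraicGeometry

namespace Literature.Barriers.HodgeConjecture

open Literature.AlgebraicGeometry Literature.AlgebraicGeometry.Motives Literature.AlgebraicGeometry.HodgeTheory

universe u

variable {B : BettiHodgeData ℂ} {𝒳 𝒳₁ 𝒳₂ S : SchemeOver ℂ} {f : 𝒳 ⟶ S} {f₁ : 𝒳₁ ⟶ S} {f₂ : 𝒳₂ ⟶ S} {n n₁ n₂ i p : ℕ}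
variable {α ι : Type*} {ψ : α → OpenPartialHomeomorph (ComplexPoints S) ℂ} {σ : ι → ℂ → ComplexPoints S}
variable {X : Type*} [TopologicalSpace X] [CompactSpace X]

/-! ## §1 From bundled flat charts over a punctured compact (or complete) curve -/

/-- **Cattani–Deligne–Kaplan over a curve: THE NON-GENERIC HODGE LOCUS IS ZARISKI CLOSED ON POINTS.**  `D : GeometricVHSData B f n (2p)` over `S(ℂ)`
preconnected, `S` locally of finite type, `D` locally flat-charted by the discs `ψ a` (covering `S(ℂ)`) and the ends `σ i′` read off a compactification
`j : S(ℂ) ↪ X`; then for every `K` the set of `t ∈ S(ℂ)` carrying a class `u ∈ H^{2p}(𝒳_t)_ℤ` of type `(p,p)` with `Q(u,u) ≤ K` admitting NO determination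
of type `(p,p)` at some complex point is the set of complex points of a Zariski-closed subset of `S` (it is finite).
[cite: CattaniDeligneKaplan1995, §1, Thm. 1.1, Cor. 1.3 (p. 484), «Proof of 1.5 ⟹ 1.1» (p. 485), 2.3 (p. 487)] [cite: Hartshorne1977, Ch. II Ex. 3.14] -/
theorem isZariskiClosedOnPoints_nonGenericHodgeLocus_of_isLocallyFlatCharted_of_compactification [PreconnectedSpace (ComplexPoints S)]
    [LocallyOfFiniteType S.hom] (D : GeometricVHSData B f n (2 * p)) (h : D.toVHSData.IsLocallyFlatCharted ψ σ) (K : ℤ)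
    (hcov : ∀ x : ComplexPoints S, ∃ a, x ∈ (ψ a).source) (A : ι → ℝ)
    {j : ComplexPoints S → X} (hj : IsEmbedding j) (pt : ι → X) (hpS : ∀ i, pt i ∉ range j) (hcovX : ∀ x : X, x ∉ range j → ∃ i, x = pt i)
    (φ : ι → OpenPartialHomeomorph X ℂ) (hp : ∀ i, pt i ∈ (φ i).source) (hφp : ∀ i, φ i (pt i) = 0)
    (hball : ∀ i, Metric.ball (0 : ℂ) (Real.exp (-(2 * Real.pi * A i))) ⊆ (φ i).target)
    (hσ : ∀ (i : ι) (z : ℂ), A i < z.im → j (σ i z) = (φ i).symm (Complex.exp (2 * Real.pi * Complex.I * z))) :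
    IsZariskiClosedOnPoints S (D.toVHSData.nonGenericHodgeLocus p K) :=
  isZariskiClosedOnPoints_of_finite
    (h.finite_nonGenericHodgeLocus_of_compactification (natCast_add_self_eq_natCast_two_mul p) K hcov A hj pt hpS hcovX φ hp hφp hball hσ)

/-- **ALL BUT FINITELY MANY BOUNDED HODGE CLASSES OF A GEOMETRIC VARIATION OVER A PUNCTURED COMPACT CURVE ARE GENERIC, as a PROPER Zariski-closed
exceptional set**: there is a set `Z ⊆ S(ℂ)` of complex points of a Zariski-closed subset of `S`, `Z ≠ S(ℂ)` (`S(ℂ)` is infinite: it is covered by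
coordinate discs), such that at every `t ∉ Z` every class `u ∈ H^{2p}(𝒳_t)_ℤ` of type `(p,p)` with `Q(u,u) ≤ K` has, at EVERY complex point `t′`, a
determination `γ · u` of type `(p,p)`. [cite: CattaniDeligneKaplan1995, §1, Thm. 1.1, Cor. 1.3 (p. 484), «Proof of 1.5 ⟹ 1.1» (p. 485), 2.3 (p. 487)]
[cite: Hartshorne1977, Ch. II Ex. 3.14] -/
theorem exists_isZariskiClosedOnPoints_ne_univ_forall_generic_of_compactification [PreconnectedSpace (ComplexPoints S)]
    [LocallyOfFiniteType S.hom] (D : GeometricVHSData B f n (2 * p)) (h : D.toVHSData.IsLocallyFlatCharted ψ σ) (K : ℤ)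
    (hcov : ∀ x : ComplexPoints S, ∃ a, x ∈ (ψ a).source) (A : ι → ℝ)
    {j : ComplexPoints S → X} (hj : IsEmbedding j) (pt : ι → X) (hpS : ∀ i, pt i ∉ range j) (hcovX : ∀ x : X, x ∉ range j → ∃ i, x = pt i)
    (φ : ι → OpenPartialHomeomorph X ℂ) (hp : ∀ i, pt i ∈ (φ i).source) (hφp : ∀ i, φ i (pt i) = 0)
    (hball : ∀ i, Metric.ball (0 : ℂ) (Real.exp (-(2 * Real.pi * A i))) ⊆ (φ i).target)
    (hσ : ∀ (i : ι) (z : ℂ), A i < z.im → j (σ i z) = (φ i).symm (Complex.exp (2 * Real.pi * Complex.I * z))) [Nonempty (ComplexPoints S)] :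
    ∃ Z : Set (ComplexPoints S), IsZariskiClosedOnPoints S Z ∧ Z ≠ univ ∧
      ∀ t ∉ Z, ∀ u : D.VZ.fiber t, D.IsHodgeAt t p u → (D.form t).form (D.toRat t u) (D.toRat t u) ≤ (K : ℚ) →
        ∀ t' : ComplexPoints S, ∃ γ : Path.Homotopic.Quotient t t', D.IsHodgeAt t' p (D.VZ.transport γ u) := by
  have hfin := h.finite_nonGenericHodgeLocus_of_compactification (natCast_add_self_eq_natCast_two_mul p) K hcov A hj pt hpS hcovX φ hp hφp hball hσ
  refine ⟨D.toVHSData.nonGenericHodgeLocus p K, isZariskiClosedOnPoints_of_finite hfin, fun huniv => ?_,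
    fun t ht u hu hK t' => D.toVHSData.exists_isHodgeAt_transport_of_not_mem_nonGenericHodgeLocus ht hu hK t'⟩
  obtain ⟨x⟩ := ‹Nonempty (ComplexPoints S)›
  exact (infinite_of_isOpen_of_nonempty ψ hcov isOpen_univ ⟨x, mem_univ x⟩) (huniv ▸ hfin)

/-- **Over a COMPLETE curve** (`S(ℂ)` compact, no ends: flat interior charts alone). [cite: CattaniDeligneKaplan1995, §1, Thm. 1.1, Cor. 1.3 (p. 484)]
[cite: Hartshorne1977, Ch. II Ex. 3.14] -/
theorem isZariskiClosedOnPoints_nonGenericHodgeLocus_of_isLocallyFlatCharted_of_compactSpace [CompactSpace (ComplexPoints S)]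
    [PreconnectedSpace (ComplexPoints S)] [LocallyOfFiniteType S.hom] [IsEmpty ι] (D : GeometricVHSData B f n (2 * p))
    (h : D.toVHSData.IsLocallyFlatCharted ψ σ) (K : ℤ) (hcov : ∀ x : ComplexPoints S, ∃ a, x ∈ (ψ a).source) :
    IsZariskiClosedOnPoints S (D.toVHSData.nonGenericHodgeLocus p K) :=
  isZariskiClosedOnPoints_of_finite (h.finite_nonGenericHodgeLocus_of_compactSpace (natCast_add_self_eq_natCast_two_mul p) K hcov)

/-! ## §2 Through a cover by a punctured compact curve -/

/-- **THE NON-GENERIC HODGE LOCUS THROUGH A SURJECTIVE COVER BY A PUNCTURED COMPACT CURVE CARRYING FLAT CHARTS OF `φ^*D`, as Zariski closedness on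
points** («replace `S` by a finite etale covering»; finiteness of the non-generic locus descends along any continuous surjection).
[cite: CattaniDeligneKaplan1995, §1, Thm. 1.1, Cor. 1.3 (p. 484), «Proof of 1.5 ⟹ 1.1» (p. 485), 2.3 (p. 487)] [cite: Hartshorne1977, Ch. II Ex. 3.14] -/
theorem isZariskiClosedOnPoints_nonGenericHodgeLocus_of_cover_of_compactification [LocallyOfFiniteType S.hom] {T : Type} [TopologicalSpace T]
    [PreconnectedSpace T] (φ : C(T, ComplexPoints S)) (hφ : Function.Surjective φ) (D : GeometricVHSData B f n (2 * p))
    {α' ι' : Type*} {ψ' : α' → OpenPartialHomeomorph T ℂ} {σ' : ι' → ℂ → T} (h : (D.toVHSData.comap φ).IsLocallyFlatCharted ψ' σ') (K : ℤ)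
    (hcov : ∀ x : T, ∃ a, x ∈ (ψ' a).source) (A : ι' → ℝ)
    {j : T → X} (hj : IsEmbedding j) (pt : ι' → X) (hpS : ∀ i, pt i ∉ range j) (hcovX : ∀ x : X, x ∉ range j → ∃ i, x = pt i)
    (φc : ι' → OpenPartialHomeomorph X ℂ) (hp : ∀ i, pt i ∈ (φc i).source) (hφp : ∀ i, φc i (pt i) = 0)
    (hball : ∀ i, Metric.ball (0 : ℂ) (Real.exp (-(2 * Real.pi * A i))) ⊆ (φc i).target)
    (hσ : ∀ (i : ι') (z : ℂ), A i < z.im → j (σ' i z) = (φc i).symm (Complex.exp (2 * Real.pi * Complex.I * z))) :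
    IsZariskiClosedOnPoints S (D.toVHSData.nonGenericHodgeLocus p K) :=
  isZariskiClosedOnPoints_of_finite
    (D.toVHSData.finite_nonGenericHodgeLocus_of_comap_of_isLocallyFlatCharted_of_compactification φ hφ h (natCast_add_self_eq_natCast_two_mul p)
      K hcov A hj pt hpS hcovX φc hp hφp hball hσ)

/-- **THE NON-GENERIC HODGE LOCUS FROM FLAT INTERIOR CHARTS OF `D` ON `S(ℂ)` AND FLAT PUNCTURE CHARTS OF `φ^*D` ON A COVERING BY A PUNCTURED COMPACT
CURVE, as Zariski closedness on points** (`φ` surjective with sheets `e_b` covering `T`; discs `ψ_a` covering `S(ℂ)`).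
[cite: CattaniDeligneKaplan1995, §1, Thm. 1.1, Cor. 1.3 (p. 484), «Proof of 1.5 ⟹ 1.1» (p. 485), 2.3 (p. 487), (2.4) (p. 488)]
[cite: FritzscheGrauert2002, Ch. IV §1] [cite: Hartshorne1977, Ch. II Ex. 3.14] -/
theorem isZariskiClosedOnPoints_nonGenericHodgeLocus_of_sheets_of_compactification [LocallyOfFiniteType S.hom] {T : Type} [TopologicalSpace T]
    [PreconnectedSpace T] (φ : C(T, ComplexPoints S)) (hφ : Function.Surjective φ) (D : GeometricVHSData B f n (2 * p))
    {αS β ι' : Type*} (ψS : αS → OpenPartialHomeomorph (ComplexPoints S) ℂ) (E : β → OpenPartialHomeomorph T (ComplexPoints S))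
    (hE : ∀ b x, E b x = φ x) (hcov : ∀ y : ComplexPoints S, ∃ a, y ∈ (ψS a).source) (hcov' : ∀ x : T, ∃ b, x ∈ (E b).source)
    (hint : ∀ a, ∀ y ∈ (ψS a).source, ∃ r > 0, Metric.ball (ψS a y) r ⊆ (ψS a).target ∧
      ∃ (V : Type) (_ : AddCommGroup V) (_ : Module ℚ V) (_ : FiniteDimensional ℚ V) (H₀ : HodgeStructure V ((2 * p : ℕ) : ℤ))
        (P₀ : H₀.Polarization) (C : D.toVHSData.InteriorChart (Literature.Topology.restrBall (ψS a) y r) P₀), C.IsFlat)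
    {σ' : ι' → ℂ → T}
    (hpunct : ∀ i, ∃ (V : Type) (_ : AddCommGroup V) (_ : Module ℚ V) (_ : FiniteDimensional ℚ V)
      (L : PolarizedLimitMixedHodgeStructure V ((2 * p : ℕ) : ℤ)) (C : (D.toVHSData.comap φ).PunctureChart (σ' i) L), C.IsFlat)
    (K : ℤ) (A : ι' → ℝ) {j : T → X} (hj : IsEmbedding j) (pt : ι' → X) (hpS : ∀ i, pt i ∉ range j)
    (hcovX : ∀ x : X, x ∉ range j → ∃ i, x = pt i) (φc : ι' → OpenPartialHomeomorph X ℂ) (hp : ∀ i, pt i ∈ (φc i).source)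
    (hφp : ∀ i, φc i (pt i) = 0) (hball : ∀ i, Metric.ball (0 : ℂ) (Real.exp (-(2 * Real.pi * A i))) ⊆ (φc i).target)
    (hσ : ∀ (i : ι') (z : ℂ), A i < z.im → j (σ' i z) = (φc i).symm (Complex.exp (2 * Real.pi * Complex.I * z))) :
    IsZariskiClosedOnPoints S (D.toVHSData.nonGenericHodgeLocus p K) :=
  isZariskiClosedOnPoints_of_finite
    (D.toVHSData.finite_nonGenericHodgeLocus_of_sheets φ ψS E hE hφ hcov hcov' hint hpunct (natCast_add_self_eq_natCast_two_mul p) K A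
      (Literature.Topology.isOpen_image_ends hj φc A hball σ' hσ) (Literature.Topology.exists_isCompact_core hj pt hpS hcovX φc hp hφp A hball σ' hσ)
      (continuousOn_end_lifts hj φc A hball σ' hσ))

/-! ## §3 Tensor constructions, from flat charts of `D` (resp. `D₁`, `D₂`) alone -/

/-- **FOR `T^{a,b}(Rⁱ f_* ℚ)`** (`q + q = a·i − b·i`), over a punctured compact curve, from flat charts of `D`: the non-generic Hodge locus is Zariski
closed on points. [cite: CattaniDeligneKaplan1995, §1, Thm. 1.1, Cor. 1.3 (p. 484), 2.3 (p. 487)] [cite: Hartshorne1977, Ch. II Ex. 3.14] -/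
theorem isZariskiClosedOnPoints_nonGenericHodgeLocus_tensorSpace_of_compactification [PreconnectedSpace (ComplexPoints S)]
    [LocallyOfFiniteType S.hom] (D : GeometricVHSData B f n i) (h : D.toVHSData.IsLocallyFlatCharted ψ σ) (a b : ℕ) {q : ℤ}
    (hq : q + q = (a : ℤ) * i + (b : ℤ) * (-(i : ℤ))) (K : ℤ) (hcov : ∀ x : ComplexPoints S, ∃ a, x ∈ (ψ a).source) (A : ι → ℝ)
    {j : ComplexPoints S → X} (hj : IsEmbedding j) (pt : ι → X) (hpS : ∀ i, pt i ∉ range j) (hcovX : ∀ x : X, x ∉ range j → ∃ i, x = pt i)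
    (φ : ι → OpenPartialHomeomorph X ℂ) (hp : ∀ i, pt i ∈ (φ i).source) (hφp : ∀ i, φ i (pt i) = 0)
    (hball : ∀ i, Metric.ball (0 : ℂ) (Real.exp (-(2 * Real.pi * A i))) ⊆ (φ i).target)
    (hσ : ∀ (i : ι) (z : ℂ), A i < z.im → j (σ i z) = (φ i).symm (Complex.exp (2 * Real.pi * Complex.I * z))) :
    IsZariskiClosedOnPoints S ((D.toVHSData.tensorSpace a b).nonGenericHodgeLocus q K) :=
  isZariskiClosedOnPoints_of_finite
    ((h.tensorSpace a b).finite_nonGenericHodgeLocus_of_compactification hq K hcov A hj pt hpS hcovX φ hp hφp hball hσ)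

/-- **FOR THE MORPHISM CLASSES `Hom(Rⁱ¹ f₁,* ℚ, Rⁱ² f₂,* ℚ)`** of two families over the same punctured compact curve (`q + q = i₂ − i₁`), from flat
charts of `D₁`, `D₂`. [cite: CattaniDeligneKaplan1995, §1, Thm. 1.1, Cor. 1.3 (p. 484), 2.3 (p. 487)] [cite: Hartshorne1977, Ch. II Ex. 3.14] -/
theorem isZariskiClosedOnPoints_nonGenericHodgeLocus_hom_of_compactification [PreconnectedSpace (ComplexPoints S)] [LocallyOfFiniteType S.hom]
    {i₁ i₂ : ℕ} (D₁ : GeometricVHSData B f₁ n₁ i₁) (D₂ : GeometricVHSData B f₂ n₂ i₂) (h₁ : D₁.toVHSData.IsLocallyFlatCharted ψ σ)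
    (h₂ : D₂.toVHSData.IsLocallyFlatCharted ψ σ) {q : ℤ} (hq : q + q = (i₂ : ℤ) - (i₁ : ℤ)) (K : ℤ)
    (hcov : ∀ x : ComplexPoints S, ∃ a, x ∈ (ψ a).source) (A : ι → ℝ)
    {j : ComplexPoints S → X} (hj : IsEmbedding j) (pt : ι → X) (hpS : ∀ i, pt i ∉ range j) (hcovX : ∀ x : X, x ∉ range j → ∃ i, x = pt i)
    (φ : ι → OpenPartialHomeomorph X ℂ) (hp : ∀ i, pt i ∈ (φ i).source) (hφp : ∀ i, φ i (pt i) = 0)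
    (hball : ∀ i, Metric.ball (0 : ℂ) (Real.exp (-(2 * Real.pi * A i))) ⊆ (φ i).target)
    (hσ : ∀ (i : ι) (z : ℂ), A i < z.im → j (σ i z) = (φ i).symm (Complex.exp (2 * Real.pi * Complex.I * z))) :
    IsZariskiClosedOnPoints S ((D₁.toVHSData.hom D₂.toVHSData).nonGenericHodgeLocus q K) :=
  isZariskiClosedOnPoints_of_finite
    ((h₁.hom h₂).finite_nonGenericHodgeLocus_of_compactification hq K hcov A hj pt hpS hcovX φ hp hφp hball hσ)

end Literature.Barriers.HodgeConjecture

end
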